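import Summits.HodgeConjecture.HodgeConjecture.Theses.EndoscopicMiddleDegree
import Literature.AlgebraicGeometry.ShimuraVarieties.SpecialCycleClasses

/-!
# `MiddleThetaSpan` (stmt-HodgeConjecture-13661) · Negative · the rank inequality forced by the crux

Negative knowledge for the crux `EndoscopicMiddleDegree.MiddleThetaSpan` (route
EndoscopicMiddleDegree, rank 2). The three summands of the crux are a special-cycle span and two
BILINEAR IMAGES `map₂ (∪) S N¹` (`span_cup_eq_map₂`, `span_cup_eq_map₂_span`), so the crux has a
numerical shadow: for every datum `D` and every endomorphism `e` of `H^{2n}(X(ℂ); ℂ)` killing the special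
`n`-cycle classes `SCⁿ(D)`, the rank of the image under `e` of the span of the rational `(n,n)`-classes is
at most `rk SC^{n-1} · rk N¹ + rk (Hdg^{n-1,n-1}_ℚ ⊗ ℂ) · rk N¹`
(`rank_map_span_ratHodge_le_of_middleThetaSpan`, through `rank_map₂_le`: rank of a bilinear image ≤
product of ranks). Intended `e`: the Hecke projector onto the sum `Π_T(K)` of the Tate-type
`A(n,n)`-pieces whose theta-dichotomy space is NOT split (there `SCⁿ_K` projects to zero), so the crux
forces `dim Π_T(K) ≲ 2 h^{n-1,n-1}(X_K) h^{1,1}(X_K)` at every level. WHY THIS DOES NOT REFUTE THE CRUX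
ASYMPTOTICALLY (`n = 2`, full-level towers): by Marshall–Shin (arXiv:1804.05047 Thm 1.2, conditional on
the KMSW classification) `h²(X(𝔫)) ≪ N𝔫^{11}`, expected sharp for the `A(1,1)`-shape `(3,1),(1,2)`, so the
bound is `≍ N𝔫^{22}`, whereas the whole Tate-type shape `(1,4),(1,1)` is `≪ N𝔫^{21+ε}` (their Prop.
singlefinite + Savin): products of divisor classes outnumber all Tate-type `(2,2)`-classes by a power of
the level. The inequality is recorded as the exact shape of a finite, computable falsifier at a specific
level (disprover's work file `Cruxes/MiddleThetaSpan/Disproof.lean`, F8/F10: only levels bad at ≥ 2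
non-split places are exposed). Its `m = 1` sharpening `rank_map_span_ratHodge_le_of_middleThetaSpan_one`
(F11) also lets `e` kill the products of two `T`-split divisor classes (`Pₛ · Pₛ`; Kudla–Millson:
`SC¹·SC¹ ⊆ SC² + L·H²`, seesaw) and bounds by `rk N¹ · rk D₂`, `D₂` = theta divisors from planes
anisotropic at a place of `T`: `D₂ = 0 ≠ Π_T` at ONE level refutes the crux — the finite test to run at
the smallest two-bad-place levels. `specialCycleClasses D k` is by `rfl` the route file's inlined
rendering.
Refuter seat refuter-cdisprove-stmt-HodgeConjecture-13661-g2-0 (cdisprove cycle 2), 2026-08-16.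
-/

noncomputable section

-- The mandated namespace `Summit.<P>.<Sub>.Theorems.…` repeats `HodgeConjecture` (single-conjunct summit).
set_option linter.dupNamespace false

namespace Summit.HodgeConjecture.HodgeConjecture.Theorems.MiddleThetaSpan.Negative.RankBound

open Literature.AlgebraicGeometry Literature.AlgebraicGeometry.HodgeTheory
  Literature.AlgebraicGeometry.ShimuraVarieties Literature.AlgebraicTopology.SingularHomology
open Summit.HodgeConjecture.HodgeConjecture.Theses.EndoscopicMiddleDegree (MiddleThetaSpan)

universe u v in
open scoped TensorProduct in
/-- Rank of the span of a bilinear image is at most the product of the ranks (it is a quotient of the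
tensor product). [folklore] -/
theorem rank_map₂_le {K : Type u} [Field K] {M N P : Type v} [AddCommGroup M] [Module K M]
    [AddCommGroup N] [Module K N] [AddCommGroup P] [Module K P]
    (f : M →ₗ[K] N →ₗ[K] P) (p : Submodule K M) (q : Submodule K N) :
    Module.rank K (Submodule.map₂ f p q) ≤ Module.rank K p * Module.rank K q := by
  let g : p ⊗[K] q →ₗ[K] P := TensorProduct.lift (f.domRestrict₁₂ p q)
  have hle : Submodule.map₂ f p q ≤ LinearMap.range g := by
    refine Submodule.map₂_le.2 fun m hm n hn ↦ ⟨⟨m, hm⟩ ⊗ₜ ⟨n, hn⟩, ?_⟩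
    simp [g, LinearMap.domRestrict₁₂_apply]
  calc Module.rank K (Submodule.map₂ f p q) ≤ Module.rank K (LinearMap.range g) :=
        Submodule.rank_mono hle
    _ ≤ Module.rank K (p ⊗[K] q) := rank_range_le g
    _ = Module.rank K p * Module.rank K q := rank_tensorProduct' ..

universe u v in
/-- The shape lemma behind the rank bound: if a set `R` lies in `S₁ ⊔ map₂ f S₂ N ⊔ map₂ f (span A) N`
and `e` kills `S₁`, then `rk e(span R) ≤ rk S₂ · rk N + rk (span A) · rk N`. [folklore] -/
theorem rank_map_span_le_of_subset_sup₃ {K : Type u} [Field K] {M N P : Type v} [AddCommGroup M]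
    [Module K M] [AddCommGroup N] [Module K N] [AddCommGroup P] [Module K P]
    (f : M →ₗ[K] N →ₗ[K] P) (S₁ : Submodule K P) (S₂ : Submodule K M) (A : Set M)
    (T : Submodule K N) (R : Set P)
    (hR : R ⊆ ↑(S₁ ⊔ Submodule.map₂ f S₂ T ⊔ Submodule.map₂ f (Submodule.span K A) T))
    (e : P →ₗ[K] P) (he : S₁ ≤ LinearMap.ker e) :
    Module.rank K ((Submodule.span K R).map e) ≤
      Module.rank K S₂ * Module.rank K T + Module.rank K (Submodule.span K A) * Module.rank K T := by
  have hle : Submodule.span K R ≤ S₁ ⊔ Submodule.map₂ f S₂ T ⊔ Submodule.map₂ f (Submodule.span K A) T :=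
    Submodule.span_le.2 hR
  have hmap : (Submodule.span K R).map e ≤
      (Submodule.map₂ f S₂ T).map e ⊔ (Submodule.map₂ f (Submodule.span K A) T).map e := by
    refine (Submodule.map_mono hle).trans ?_
    rw [Submodule.map_sup, Submodule.map_sup]
    have h1 : S₁.map e = ⊥ := by
      rw [eq_bot_iff, Submodule.map_le_iff_le_comap]
      exact he
    rw [h1, bot_sup_eq]
  calc Module.rank K ((Submodule.span K R).map e)
      ≤ Module.rank K ↥((Submodule.map₂ f S₂ T).map e ⊔
          (Submodule.map₂ f (Submodule.span K A) T).map e) := Submodule.rank_mono hmap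
    _ ≤ Module.rank K ((Submodule.map₂ f S₂ T).map e) +
          Module.rank K ((Submodule.map₂ f (Submodule.span K A) T).map e) :=
        Submodule.rank_add_le_rank_add_rank _ _
    _ ≤ Module.rank K (Submodule.map₂ f S₂ T) +
          Module.rank K (Submodule.map₂ f (Submodule.span K A) T) :=
        add_le_add (rank_map_le e _) (rank_map_le e _)
    _ ≤ _ := add_le_add (rank_map₂_le _ _ _) (rank_map₂_le _ _ _)

variable {p : ℕ} {X : Motives.SchemeOver ℂ}

/-- The route file's set-builder rendering `{z | ∃ s ∈ S, ∃ d ∈ T, z = s ∪ d}` spans `map₂ (∪) S T`.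
[folklore] -/
theorem span_cup_eq_map₂ {i j n : ℕ} (h : i + j = n) (S : Submodule ℂ (complexBetti X i))
    (T : Submodule ℂ (complexBetti X j)) :
    Submodule.span ℂ {z : complexBetti X n | ∃ s ∈ S, ∃ d ∈ T, z = cupProduct h s d} =
      Submodule.map₂ (cupProduct h) S T := by
  rw [Submodule.map₂_eq_span_image2]
  congr 1
  ext z
  simp only [Set.mem_setOf_eq, Set.mem_image2, SetLike.mem_coe]
  constructor
  · rintro ⟨s, hs, d, hd, rfl⟩; exact ⟨s, hs, d, hd, rfl⟩
  · rintro ⟨s, hs, d, hd, rfl⟩; exact ⟨s, hs, d, hd, rfl⟩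

/-- Same with the first factor ranging over a SET `A` (the rational `(m,m)`-classes): the span is
`map₂ (∪) (span A) T`. [folklore] -/
theorem span_cup_eq_map₂_span {i j n : ℕ} (h : i + j = n) (A : Set (complexBetti X i))
    (T : Submodule ℂ (complexBetti X j)) :
    Submodule.span ℂ {z : complexBetti X n | ∃ a : complexBetti X i, a ∈ A ∧ ∃ d ∈ T,
        z = cupProduct h a d} = Submodule.map₂ (cupProduct h) (Submodule.span ℂ A) T := by
  conv_rhs => rw [← Submodule.span_eq T]
  rw [Submodule.map₂_span_span]
  congr 1
  ext z
  simp only [Set.mem_setOf_eq, Set.mem_image2, SetLike.mem_coe]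
  constructor
  · rintro ⟨s, hs, d, hd, rfl⟩; exact ⟨s, hs, d, hd, rfl⟩
  · rintro ⟨s, hs, d, hd, rfl⟩; exact ⟨s, hs, d, hd, rfl⟩

/-- The inlined special-cycle span of the route file is `specialCycleClasses` (the cone-repair rendering
is `rfl`). [cite: BergeronMillsonMoeglin2016Balls, Introduction §1.7] -/
theorem iSup_eq_specialCycleClasses (D : UnitaryBallQuotientDatum p X) (k : ℕ) :
    (⨆ (W : Submodule D.E (Fin (p + 1) → D.E)) (_ : IsTotallyPositive (conjRingHom D.E) D.H W)
      (_ : Module.finrank D.E W = k), classesSupportedOn X (D.specialSubvariety W) (2 * k)) =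
      specialCycleClasses D k := rfl

/-- **The rank inequality forced by `MiddleThetaSpan`.** For every endomorphism `e` of `H^{2n}` killing
`SCⁿ(D)`, the `e`-image of the span of the rational `(n,n)`-classes has rank at most
`rk SC^{n-1} · rk N¹ + rk (span of rational (n-1,n-1)-classes) · rk N¹`. A level at which the Tate-type
`(n,n)`-classes with non-split dichotomy space outnumber this bound refutes the crux (class misstated);
asymptotically they do not (module docstring). [cite: MarshallShin2019EndoscopyCohomologyUn1, Theorem 1.2] -/
theorem rank_map_span_ratHodge_le_of_middleThetaSpan (h : MiddleThetaSpan) {m : ℕ}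
    (D : UnitaryBallQuotientDatum (2 * (m + 1)) X) (hm1 : 1 ≤ m) (hm2 : m ≤ 2)
    (e : complexBetti X (2 * (m + 1)) →ₗ[ℂ] complexBetti X (2 * (m + 1)))
    (he : specialCycleClasses D (m + 1) ≤ LinearMap.ker e) :
    Module.rank ℂ ((Submodule.span ℂ {c : complexBetti X (2 * (m + 1)) | IsRationalClass c ∧
        IsOfHodgeType (2 * (m + 1)) X (2 * (m + 1)) (m + 1) (m + 1) c}).map e) ≤
      Module.rank ℂ (specialCycleClasses D m) * Module.rank ℂ (algebraicClasses X 1) +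
        Module.rank ℂ (Submodule.span ℂ {a : complexBetti X (2 * m) | IsRationalClass a ∧
            IsOfHodgeType (2 * (m + 1)) X (2 * m) m m a}) * Module.rank ℂ (algebraicClasses X 1) := by
  refine rank_map_span_le_of_subset_sup₃ (cupProduct (two_mul_add_two_mul m 1))
    (specialCycleClasses D (m + 1)) (specialCycleClasses D m) _ (algebraicClasses X 1) _ ?_ e he
  rintro c ⟨hc, hH⟩
  have hc' := h m X D hm1 hm2 c hc hH
  rw [iSup_eq_specialCycleClasses, iSup_eq_specialCycleClasses, span_cup_eq_map₂] at hc'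
  have e3 : Submodule.span ℂ {z : complexBetti X (2 * (m + 1)) |
      ∃ a : complexBetti X (2 * m), IsRationalClass a ∧
        IsOfHodgeType (2 * (m + 1)) X (2 * m) m m a ∧
          ∃ d ∈ algebraicClasses X 1, z = cupProduct (two_mul_add_two_mul m 1) a d} =
      Submodule.map₂ (cupProduct (two_mul_add_two_mul m 1))
        (Submodule.span ℂ {a : complexBetti X (2 * m) | IsRationalClass a ∧
          IsOfHodgeType (2 * (m + 1)) X (2 * m) m m a}) (algebraicClasses X 1) := by
    rw [← span_cup_eq_map₂_span]
    congr; ext z; simp only [Set.mem_setOf_eq, and_assoc]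
  rw [e3] at hc'
  exact hc'


/-! ### The `m = 1` sharpening (F11): products of two `T`-split divisor classes are invisible -/

universe u v in
/-- Shape lemma for F11: if `R ⊆ S₁ ⊔ map₂ f N N` with `N ≤ Pₛ ⊔ D₂`, `f` symmetric, and `e` kills
`S₁` and `map₂ f Pₛ Pₛ`, then `rk e(span R) ≤ rk (Pₛ ⊔ D₂) · rk D₂`. [folklore] -/
theorem rank_map_span_le_of_symm_of_kills_sq {K : Type u} [Field K] {M P : Type v} [AddCommGroup M]
    [Module K M] [AddCommGroup P] [Module K P]
    (f : M →ₗ[K] M →ₗ[K] P) (hf : ∀ a b : M, f a b = f b a) (S₁ : Submodule K P)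
    (N Pₛ D₂ : Submodule K M) (hN : N ≤ Pₛ ⊔ D₂) (R : Set P)
    (hR : R ⊆ ↑(S₁ ⊔ Submodule.map₂ f N N))
    (e : P →ₗ[K] P) (he₁ : S₁ ≤ LinearMap.ker e) (he₂ : Submodule.map₂ f Pₛ Pₛ ≤ LinearMap.ker e) :
    Module.rank K ((Submodule.span K R).map e) ≤ Module.rank K ↥(Pₛ ⊔ D₂) * Module.rank K D₂ := by
  have hflip : f.flip = f := by
    ext a b; exact (hf a b).symm
  have hcomm : Submodule.map₂ f D₂ Pₛ = Submodule.map₂ f Pₛ D₂ := by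
    rw [← Submodule.map₂_flip f Pₛ D₂, hflip]
  have hle : Submodule.span K R ≤ S₁ ⊔ (Submodule.map₂ f Pₛ Pₛ ⊔ Submodule.map₂ f (Pₛ ⊔ D₂) D₂) := by
    refine (Submodule.span_le.2 hR).trans (sup_le_sup_left ?_ _)
    calc Submodule.map₂ f N N ≤ Submodule.map₂ f (Pₛ ⊔ D₂) (Pₛ ⊔ D₂) := Submodule.map₂_le_map₂ hN hN
      _ = Submodule.map₂ f Pₛ Pₛ ⊔ Submodule.map₂ f D₂ Pₛ ⊔
            (Submodule.map₂ f Pₛ D₂ ⊔ Submodule.map₂ f D₂ D₂) := by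
          rw [Submodule.map₂_sup_right, Submodule.map₂_sup_left, Submodule.map₂_sup_left]
      _ ≤ Submodule.map₂ f Pₛ Pₛ ⊔ Submodule.map₂ f (Pₛ ⊔ D₂) D₂ := by
          rw [hcomm, Submodule.map₂_sup_left]
          refine sup_le (sup_le le_sup_left ?_) ?_
          · exact le_sup_of_le_right le_sup_left
          · exact le_sup_right
  have hmap : (Submodule.span K R).map e ≤ (Submodule.map₂ f (Pₛ ⊔ D₂) D₂).map e := by
    refine (Submodule.map_mono hle).trans ?_
    rw [Submodule.map_sup, Submodule.map_sup]
    have h1 : S₁.map e = ⊥ := by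
      rw [eq_bot_iff, Submodule.map_le_iff_le_comap]; exact he₁
    have h2 : (Submodule.map₂ f Pₛ Pₛ).map e = ⊥ := by
      rw [eq_bot_iff, Submodule.map_le_iff_le_comap]; exact he₂
    rw [h1, h2, bot_sup_eq, bot_sup_eq]
  calc Module.rank K ((Submodule.span K R).map e)
      ≤ Module.rank K ((Submodule.map₂ f (Pₛ ⊔ D₂) D₂).map e) := Submodule.rank_mono hmap
    _ ≤ Module.rank K (Submodule.map₂ f (Pₛ ⊔ D₂) D₂) := rank_map_le e _
    _ ≤ _ := rank_map₂_le _ _ _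

/-- **F11 — the `m = 1` counting falsifier.** On a compact arithmetic 4-ball quotient (datum `D`),
cover the divisor classes by `N¹ ≤ Pₛ ⊔ D₂` (intended: `Pₛ` = `L`, special divisors and theta divisors
from planes split at every place of `T`; `D₂` = theta divisors from planes anisotropic at some place of
`T`) and let `e` kill `SC²(D)` and all products of two classes of `Pₛ` (intended: the projector onto the
Tate-type `A(2,2)`-pieces `Π_T` with non-split dichotomy space — Kudla–Millson: `SC¹·SC¹ ⊆ SC² + L·H²`,
and the seesaw). If rational `(1,1)`-classes are algebraic (Lefschetz (1,1), hypothesis `hL`), the crux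
forces `rk e(span of rational (2,2)-classes) ≤ rk (Pₛ ⊔ D₂) · rk D₂`; so `D₂ = 0 ≠ Π_T` at some level
refutes it (class misstated). The cup product on `H²` is commutative (`cupProduct_gradedComm_holds`).
[cite: BergeronMillsonMoeglin2016Balls, Introduction Thm 4 and Remark 3] -/
theorem rank_map_span_ratHodge_le_of_middleThetaSpan_one (h : MiddleThetaSpan)
    (D : UnitaryBallQuotientDatum (2 * (1 + 1)) X)
    (hL : Submodule.span ℂ {a : complexBetti X (2 * 1) | IsRationalClass a ∧
        IsOfHodgeType (2 * (1 + 1)) X (2 * 1) 1 1 a} ≤ algebraicClasses X 1)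
    (Pₛ D₂ : Submodule ℂ (complexBetti X (2 * 1))) (hN : algebraicClasses X 1 ≤ Pₛ ⊔ D₂)
    (e : complexBetti X (2 * (1 + 1)) →ₗ[ℂ] complexBetti X (2 * (1 + 1)))
    (he₁ : specialCycleClasses D (1 + 1) ≤ LinearMap.ker e)
    (he₂ : Submodule.map₂ (cupProduct (two_mul_add_two_mul 1 1)) Pₛ Pₛ ≤ LinearMap.ker e) :
    Module.rank ℂ ((Submodule.span ℂ {c : complexBetti X (2 * (1 + 1)) | IsRationalClass c ∧
        IsOfHodgeType (2 * (1 + 1)) X (2 * (1 + 1)) (1 + 1) (1 + 1) c}).map e) ≤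
      Module.rank ℂ ↥(Pₛ ⊔ D₂) * Module.rank ℂ D₂ := by
  have hcomm : ∀ a b : complexBetti X (2 * 1), cupProduct (two_mul_add_two_mul 1 1) a b =
      cupProduct (two_mul_add_two_mul 1 1) b a := by
    intro a b
    have := cupProduct_gradedComm_holds (R := ℂ) (X := Motives.ComplexPoints X)
      (two_mul_add_two_mul 1 1) (two_mul_add_two_mul 1 1) a b
    rw [this]; norm_num
  refine rank_map_span_le_of_symm_of_kills_sq (cupProduct (two_mul_add_two_mul 1 1)) hcomm
    (specialCycleClasses D (1 + 1)) (algebraicClasses X 1) Pₛ D₂ hN _ ?_ e he₁ he₂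
  rintro c ⟨hc, hH⟩
  have hc' := h 1 X D le_rfl (by norm_num) c hc hH
  rw [iSup_eq_specialCycleClasses, iSup_eq_specialCycleClasses, span_cup_eq_map₂] at hc'
  have e3 : Submodule.span ℂ {z : complexBetti X (2 * (1 + 1)) |
      ∃ a : complexBetti X (2 * 1), IsRationalClass a ∧
        IsOfHodgeType (2 * (1 + 1)) X (2 * 1) 1 1 a ∧
          ∃ d ∈ algebraicClasses X 1, z = cupProduct (two_mul_add_two_mul 1 1) a d} =
      Submodule.map₂ (cupProduct (two_mul_add_two_mul 1 1))
        (Submodule.span ℂ {a : complexBetti X (2 * 1) | IsRationalClass a ∧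
          IsOfHodgeType (2 * (1 + 1)) X (2 * 1) 1 1 a}) (algebraicClasses X 1) := by
    rw [← span_cup_eq_map₂_span]
    congr; ext z; simp only [Set.mem_setOf_eq, and_assoc]
  rw [e3] at hc'
  have h2 : Submodule.map₂ (cupProduct (two_mul_add_two_mul 1 1)) (specialCycleClasses D 1)
      (algebraicClasses X 1) ≤ Submodule.map₂ (cupProduct (two_mul_add_two_mul 1 1))
        (algebraicClasses X 1) (algebraicClasses X 1) :=
    Submodule.map₂_le_map₂ (specialCycleClasses_le_algebraicClasses D 1) le_rfl
  have h3 : Submodule.map₂ (cupProduct (two_mul_add_two_mul 1 1))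
      (Submodule.span ℂ {a : complexBetti X (2 * 1) | IsRationalClass a ∧
        IsOfHodgeType (2 * (1 + 1)) X (2 * 1) 1 1 a}) (algebraicClasses X 1) ≤
      Submodule.map₂ (cupProduct (two_mul_add_two_mul 1 1))
        (algebraicClasses X 1) (algebraicClasses X 1) :=
    Submodule.map₂_le_map₂ hL le_rfl
  exact sup_le (sup_le_sup_left h2 _) (h3.trans le_sup_right) hc'

end Summit.HodgeConjecture.HodgeConjecture.Theorems.MiddleThetaSpan.Negative.RankBound

end
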